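import Mathlib
import Literature.NumberTheory.Transcendental.KZCubicalCalculus

/-!
# Crux `TateFamilyKernel` (stmt-KontsevichZagierPeriods-9130), line `Sketch`: `stub_oddIntegral`

Integrals of kind (d) (SYMMETRY terms) of the trichotomy normal form are invariant: for an
element `g = (σ, S)` of the hyperoctahedral group of the cube `[0,1]^D`,
`(g w)_t = 1 − w_{σ t}` if `t ∈ S` and `(g w)_t = w_{σ t}` otherwise,

  `∫_{[0,1]^D} h (g w) dw = ∫_{[0,1]^D} h (w) dw`     for EVERY `h : ℝ^D → ℝ`

(no measurability or integrability hypothesis: both sides take the same junk value otherwise).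

Proof.  `g` is the composition of the coordinate relabelling `w ↦ w ∘ σ` (Mathlib's
`MeasurableEquiv.piCongrLeft _ σ⁻¹`, volume preserving by `volume_measurePreserving_piCongrLeft`)
and the product of the reflections `x ↦ 1 − x` in the coordinates `t ∈ S` (the measurable
equivalence `MeasurableEquiv.piCongrRight`, volume preserving coordinatewise by
`Measure.measurePreserving_sub_left` and `volume_preserving_pi`).  Both pull the closed cube back to
itself, so the integral is transported along each of them by
`MeasurePreserving.setIntegral_preimage_emb`.

References: Kontsevich–Zagier 2001, §1.2 rule (2) (change of variables). No named fact, no new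
definition.
-/

noncomputable section
open MeasureTheory Set
open Literature.NumberTheory.Transcendental
namespace Summit.KontsevichZagierPeriods.InverseLandau.TateFamilyKernel.Descent

/-- Transport of the integral over the closed unit cube along a volume-preserving measurable
equivalence of `ℝ^D` pulling the cube back to itself, for an arbitrary integrand. [folklore] -/
theorem setIntegral_cube_comp_measurableEquiv {D : ℕ} (e : (Fin D → ℝ) ≃ᵐ (Fin D → ℝ))
    (he : MeasurePreserving e volume volume) (hcube : e ⁻¹' KZ.cube D = KZ.cube D)
    (f : (Fin D → ℝ) → ℝ) :
    ∫ w in KZ.cube D, f (e w) = ∫ w in KZ.cube D, f w := by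
  have key := he.setIntegral_preimage_emb e.measurableEmbedding f (KZ.cube D)
  rwa [hcube] at key

/-- Relabelling the coordinates by a permutation `σ` (`w ↦ w ∘ σ`) preserves the integral over the
closed unit cube, for an arbitrary integrand. [folklore] -/
theorem setIntegral_cube_comp_perm {D : ℕ} (σ : Equiv.Perm (Fin D)) (f : (Fin D → ℝ) → ℝ) :
    ∫ w in KZ.cube D, f (fun t => w (σ t)) = ∫ w in KZ.cube D, f w := by
  have hF : ∀ w : Fin D → ℝ,
      (MeasurableEquiv.piCongrLeft (fun _ : Fin D => ℝ) σ.symm w : Fin D → ℝ) =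
        fun t => w (σ t) := by
    intro w
    funext t
    have h := MeasurableEquiv.piCongrLeft_apply_apply (β := fun _ : Fin D => ℝ) σ.symm w (σ t)
    rwa [Equiv.symm_apply_apply] at h
  have hpre :
      (MeasurableEquiv.piCongrLeft (fun _ : Fin D => ℝ) σ.symm) ⁻¹' KZ.cube D = KZ.cube D := by
    ext w
    simp only [mem_preimage, KZ.mem_cube, hF]
    exact ⟨fun h t => by simpa using h (σ.symm t), fun h t => h (σ t)⟩
  have key := setIntegral_cube_comp_measurableEquiv _
    (volume_measurePreserving_piCongrLeft (fun _ : Fin D => ℝ) σ.symm) hpre f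
  simp_rw [hF] at key
  exact key

/-- Reflecting the coordinates in `S` (`w_t ↦ 1 − w_t` for `t ∈ S`) preserves the integral over the
closed unit cube, for an arbitrary integrand. [folklore] -/
theorem setIntegral_cube_comp_reflect {D : ℕ} (S : Finset (Fin D)) (f : (Fin D → ℝ) → ℝ) :
    ∫ w in KZ.cube D, f (fun t => if t ∈ S then 1 - w t else w t) = ∫ w in KZ.cube D, f w := by
  obtain ⟨e, he, hF⟩ : ∃ e : (Fin D → ℝ) ≃ᵐ (Fin D → ℝ), MeasurePreserving e volume volume ∧
      ∀ w : Fin D → ℝ, (e w : Fin D → ℝ) = fun t => if t ∈ S then 1 - w t else w t := by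
    refine ⟨MeasurableEquiv.piCongrRight fun t : Fin D =>
      if t ∈ S then MeasurableEquiv.subLeft (1 : ℝ) else MeasurableEquiv.refl ℝ, ?_, ?_⟩
    · have h1 : ∀ t : Fin D, MeasurePreserving
          (⇑(if t ∈ S then MeasurableEquiv.subLeft (1 : ℝ) else MeasurableEquiv.refl ℝ))
          (volume : Measure ℝ) volume := by
        intro t
        split_ifs
        · exact Measure.measurePreserving_sub_left volume (1 : ℝ)
        · exact MeasurePreserving.id volume
      exact volume_preserving_pi h1
    · intro w
      funext t
      change (if t ∈ S then MeasurableEquiv.subLeft (1 : ℝ) else MeasurableEquiv.refl ℝ) (w t) = _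
      split_ifs <;> rfl
  have hpre : e ⁻¹' KZ.cube D = KZ.cube D := by
    ext w
    simp only [mem_preimage, KZ.mem_cube, hF]
    refine ⟨fun h t => ?_, fun h t => ?_⟩
    · have ht := h t
      split_ifs at ht
      · constructor <;> linarith [ht.1, ht.2]
      · exact ht
    · have ht := h t
      split_ifs
      · constructor <;> linarith [ht.1, ht.2]
      · exact ht
  have key := setIntegral_cube_comp_measurableEquiv e he hpre f
  simp_rw [hF] at key
  exact key

/-- **Stub `stub_oddIntegral`** (integrals of kind (d) are invariant).  The hyperoctahedral map
`g = (σ, S)`, `(g w)_t = 1 − w_{σ t}` for `t ∈ S` and `w_{σ t}` otherwise, preserves Lebesgue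
measure and the closed unit cube, so `∫_{[0,1]^D} h ∘ g = ∫_{[0,1]^D} h` for every `h`
(relabelling by `σ`, then the reflections in the coordinates `S`). [folklore] -/
theorem stub_oddIntegral {D : ℕ} (σ : Equiv.Perm (Fin D)) (S : Finset (Fin D))
    (h : (Fin D → ℝ) → ℝ) :
    ∫ w in KZ.cube D, h (fun t => if t ∈ S then 1 - w (σ t) else w (σ t)) =
      ∫ w in KZ.cube D, h w := by
  have h1 := setIntegral_cube_comp_perm σ (fun v => h (fun t => if t ∈ S then 1 - v t else v t))
  have h2 := setIntegral_cube_comp_reflect S h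
  exact h1.trans h2

end Summit.KontsevichZagierPeriods.InverseLandau.TateFamilyKernel.Descent
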